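import Summits.HubbardSuperconductivity.HubbardSuperconductivity.Theorems.AnisotropyChordTransferFibre3TwoHoleBSNearInf

/-!
# Route `AnisotropyChord` / H0 rotor rung: INVERSE-FREE criteria for the three skeleton facts — strict conditional negative definiteness ⇒ `det ≠ 0 ∧ s > 0`; a zero-sum charge map ⇒ the gap of `P∞`

Thirteenth file of the `TwoHoleBS` (PROP BS) chain.  `…Fibre3TwoHoleBSMargin.dualCert_threeQuarter_near_of_gap` /
`…TwoHoleBSEventually` need, per near offset `d`, three `L`-free facts about the explicit ℤ² kernel matrix `A = skelA d`:
`IsUnit A.det`, `s = 1ᵀA⁻¹1 > 0`, and a gap `g > 0` of `P∞ = twoHolePinf A` on zero-sum boundary vectors.  All three involve `A⁻¹`,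
whose entries are degree-10 rational functions of `π`.  This file reduces them to statements LINEAR in the entries of `A` (hence
affine in `1/π`, certifiable by exact rational arithmetic, next files):
* `affine_nonneg_of_endpoints` (an affine function non-negative at both ends of an interval is non-negative inside);
* `halfPair`, `quad_halfPair` (`yᵀAy = ½A_{pq}` for `y = ½(e_p + e_q)`, zero diagonal);
* ★ `isUnit_det_of_cnd`: `A` symmetric with zero diagonal, one positive off-diagonal entry and STRICTLY conditionally negative
  definite (`cᵀAc ≤ −η‖c‖²` on zero-sum `c`, `η > 0`) ⇒ `IsUnit A.det`;  ★ `svec2_pos_of_cnd`: the same ⇒ `s > 0`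
  (the potential kernel of a recurrent walk is conditionally negative definite: `Σ c_p c_q a(p−q) = −∫|ĉ|²/ε < 0`);
* `cnd_of_form` (the certificate shape `vᵀ(−A + t·11ᵀ − η·1)v ≥ 0 ∀v` ⇒ strict CND);
* ★★ `quad_smInvInf_ge` (VARIATIONAL PRINCIPLE): for symmetric invertible CND `A` with `s ≠ 0` and ANY zero-sum charge `c`,
  `2c·y + cᵀAc ≤ yᵀE∞y`, `E∞ = smInvInf A = −A⁻¹ + x xᵀ/s` (equality at `c = E∞y`);
* `twoHolePinf_apply_smInvInf`, `quad_twoHolePinf_eq` (`wᵀP∞w = ŵᵀE∞ŵ − ½‖w‖²`, `ŵ = pad w`), `quad_chargeForm_eq`;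
* ★★ `gap_of_chargeMap`: a matrix `C` with zero column sums and `ŵᵀ(C + Cᵀ + CᵀAC)ŵ ≥ (g + ½)‖w‖²` on zero-sum `w` gives the gap
  `wᵀP∞w ≥ g‖w‖²` on zero-sum `w`.
Prover seat `hubbard-h0-rotor-p2` g3; helper for stmt-HubbardSuperconductivity-19089 (`--supports`, helper class).
WHAT THIS IS NOT: nothing here proves superconductivity in the Hubbard model; the rotor TARGET as originally worded stays
FALSE (g15 verdict).  Pure finite-dimensional linear algebra serving the near-pair tail of ONE input (HOLE₂) of ONE conditional
reduction (rung 19089).  Mathlib + tree imports only; no sorry, no axioms.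
-/

set_option linter.dupNamespace false

noncomputable section

open scoped BigOperators
open Complex Finset

namespace Summit.HubbardSuperconductivity.HubbardSuperconductivity.Theorems.AnisotropyChord.Transfer.Fibre3

namespace TwoHoleBS

/-! ## An affine function of one parameter is controlled by its endpoint values -/

/-- `0 ≤ α + aβ`, `0 ≤ α + bβ`, `a ≤ u ≤ b` ⇒ `0 ≤ α + uβ`. [folklore] -/
theorem affine_nonneg_of_endpoints (α β a b u : ℝ) (hau : a ≤ u) (hub : u ≤ b) (ha : 0 ≤ α + a * β)
    (hb : 0 ≤ α + b * β) : 0 ≤ α + u * β := by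
  rcases le_or_gt 0 β with hβ | hβ
  · nlinarith
  · nlinarith

/-! ## Strict conditional negative definiteness ⇒ invertibility and `s > 0` -/

variable (A : Matrix (Fin 5 ⊕ Fin 5) (Fin 5 ⊕ Fin 5) ℝ)

/-- the test vector `y = ½(e_p + e_q)`. [folklore] -/
def halfPair (p q : Fin 5 ⊕ Fin 5) : Fin 5 ⊕ Fin 5 → ℝ := fun r => (if r = p then 1 / 2 else 0) + (if r = q then 1 / 2 else 0)

/-- `Σ y = 1`. [folklore] -/
theorem sum_halfPair (p q : Fin 5 ⊕ Fin 5) : ∑ r, halfPair p q r = 1 := by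
  simp only [halfPair, Finset.sum_add_distrib, Finset.sum_ite_eq', Finset.mem_univ, if_true]
  norm_num

/-- `yᵀAy = ½A_{pq}` for zero diagonal, symmetric `A`, `p ≠ q`. [folklore] -/
theorem quad_halfPair (hsymm : A.IsSymm) (hdiag : ∀ r, A r r = 0) (p q : Fin 5 ⊕ Fin 5) :
    dotProduct (halfPair p q) (A.mulVec (halfPair p q)) = A p q / 2 := by
  have hqp : A q p = A p q := by simpa using hsymm.apply p q
  have hrow : ∀ r, A.mulVec (halfPair p q) r = (A r p + A r q) / 2 := by
    intro r
    simp only [Matrix.mulVec, dotProduct, halfPair, mul_add, mul_ite, mul_zero, Finset.sum_add_distrib, Finset.sum_ite_eq',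
      Finset.mem_univ, if_true]
    ring
  have h1 : dotProduct (halfPair p q) (A.mulVec (halfPair p q)) = ∑ r, halfPair p q r * ((A r p + A r q) / 2) :=
    Finset.sum_congr rfl fun r _ => by rw [hrow]
  rw [h1]
  simp only [halfPair, add_mul, ite_mul, zero_mul, Finset.sum_add_distrib, Finset.sum_ite_eq', Finset.mem_univ, if_true,
    hdiag, hqp]
  ring

/-- the certificate shape: `vᵀ(−A)v + t(Σv)² − η‖v‖² ≥ 0` for all `v` ⇒ `cᵀAc ≤ −η‖c‖²` on zero-sum `c`. [folklore] -/
theorem cnd_of_form (t η : ℝ)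
    (h : ∀ v : Fin 5 ⊕ Fin 5 → ℝ, 0 ≤ -dotProduct v (A.mulVec v) + t * (∑ r, v r) ^ 2 - η * dotProduct v v)
    (c : Fin 5 ⊕ Fin 5 → ℝ) (hc : ∑ r, c r = 0) : dotProduct c (A.mulVec c) ≤ -η * dotProduct c c := by
  have := h c
  rw [hc] at this
  linarith

/-- ★ **strict CND + zero diagonal + a positive entry ⇒ invertible.** [folklore] -/
theorem isUnit_det_of_cnd (hsymm : A.IsSymm) (hdiag : ∀ r, A r r = 0) {p q : Fin 5 ⊕ Fin 5}
    (hpos : 0 < A p q) (η : ℝ) (hη : 0 < η)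
    (hcnd : ∀ c : Fin 5 ⊕ Fin 5 → ℝ, ∑ r, c r = 0 → dotProduct c (A.mulVec c) ≤ -η * dotProduct c c) :
    IsUnit A.det := by
  rw [isUnit_iff_ne_zero]
  intro hdet
  obtain ⟨v, hv0, hv⟩ := Matrix.exists_mulVec_eq_zero_iff.mpr hdet
  by_cases hS : ∑ r, v r = 0
  · -- zero-sum kernel vector: `0 = vᵀAv ≤ −η‖v‖²`
    have h1 := hcnd v hS
    rw [hv, dotProduct_zero] at h1
    have hnn : 0 ≤ dotProduct v v := Finset.sum_nonneg fun i _ => mul_self_nonneg (v i)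
    have hne : dotProduct v v ≠ 0 := fun h => hv0 (dotProduct_self_eq_zero.mp h)
    have h2 : 0 < dotProduct v v := lt_of_le_of_ne hnn hne.symm
    nlinarith
  · -- otherwise test against `z = y − v/S`
    set S := ∑ r, v r with hSdef
    set y := halfPair p q with hy
    set z : Fin 5 ⊕ Fin 5 → ℝ := y - (1 / S) • v with hz
    have hzsum : ∑ r, z r = 0 := by
      simp only [hz, Pi.sub_apply, Pi.smul_apply, smul_eq_mul, Finset.sum_sub_distrib, ← Finset.mul_sum, ← hSdef, hy,
        sum_halfPair]
      rw [one_div_mul_cancel hS, sub_self]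
    have hAz : A.mulVec z = A.mulVec y := by
      rw [hz, Matrix.mulVec_sub, Matrix.mulVec_smul, hv, smul_zero, sub_zero]
    have hvAy : dotProduct v (A.mulVec y) = 0 := by
      rw [Matrix.dotProduct_mulVec, ← Matrix.mulVec_transpose, hsymm.eq, hv, zero_dotProduct]
    have hquad : dotProduct z (A.mulVec z) = A p q / 2 := by
      rw [hAz, hz, sub_dotProduct, smul_dotProduct, hvAy, smul_zero, sub_zero, hy, quad_halfPair A hsymm hdiag p q]
    have h1 := hcnd z hzsum
    rw [hquad] at h1
    have h2 : 0 ≤ dotProduct z z := by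
      simp only [dotProduct]; exact Finset.sum_nonneg fun i _ => mul_self_nonneg _
    nlinarith

/-- ★ **strict CND + zero diagonal + a positive entry ⇒ `s = 1ᵀA⁻¹1 > 0`.** [folklore] -/
theorem svec2_pos_of_cnd (hsymm : A.IsSymm) (hdiag : ∀ r, A r r = 0) {p q : Fin 5 ⊕ Fin 5}
    (hpos : 0 < A p q) (η : ℝ) (hη : 0 < η)
    (hcnd : ∀ c : Fin 5 ⊕ Fin 5 → ℝ, ∑ r, c r = 0 → dotProduct c (A.mulVec c) ≤ -η * dotProduct c c) :
    0 < TwoChannel.svec2 A := by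
  have hA := isUnit_det_of_cnd A hsymm hdiag hpos η hη hcnd
  set x := TwoChannel.xvec2 A with hxdef
  set s := TwoChannel.svec2 A with hsdef
  have hAx : A.mulVec x = fun _ => 1 := mulVec_xvec2 A hA
  have hs_sum : ∑ r, x r = s := rfl
  have hxAx : dotProduct x (A.mulVec x) = s := by
    rw [hAx]; simp [dotProduct, hs_sum]
  -- `s ≠ 0`
  have hs0 : s ≠ 0 := by
    intro h0
    have h1 := hcnd x (hs_sum.trans h0)
    rw [hxAx, h0] at h1
    have h2 : 0 ≤ dotProduct x x := by
      simp only [dotProduct]; exact Finset.sum_nonneg fun i _ => mul_self_nonneg _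
    have h3 : dotProduct x x = 0 := by nlinarith
    have hx0 : x = 0 := by
      funext i
      have := (Finset.sum_eq_zero_iff_of_nonneg (fun j _ => mul_self_nonneg (x j))).mp h3 i (Finset.mem_univ _)
      exact mul_self_eq_zero.mp this
    have := congrFun hAx p
    rw [hx0, Matrix.mulVec_zero] at this
    norm_num at this
  -- test vector `z = y − x/s`
  set y := halfPair p q with hy
  set z : Fin 5 ⊕ Fin 5 → ℝ := y - (1 / s) • x with hz
  have hzsum : ∑ r, z r = 0 := by
    simp only [hz, Pi.sub_apply, Pi.smul_apply, smul_eq_mul, Finset.sum_sub_distrib, ← Finset.mul_sum, hs_sum, hy,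
      sum_halfPair]
    rw [one_div_mul_cancel hs0, sub_self]
  have hyAx : dotProduct y (A.mulVec x) = 1 := by
    rw [hAx]; simp only [dotProduct, mul_one, hy, sum_halfPair]
  have hxAy : dotProduct x (A.mulVec y) = 1 := by
    rw [Matrix.dotProduct_mulVec, ← Matrix.mulVec_transpose, hsymm.eq, dotProduct_comm, hyAx]
  have hquad : dotProduct z (A.mulVec z) = A p q / 2 - 1 / s := by
    rw [hz, Matrix.mulVec_sub, Matrix.mulVec_smul, sub_dotProduct, dotProduct_sub, dotProduct_sub, smul_dotProduct,
      smul_dotProduct, dotProduct_smul, dotProduct_smul, hxAx, hyAx, hxAy, hy, quad_halfPair A hsymm hdiag p q]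
    simp only [smul_eq_mul]
    field_simp
    ring
  have h1 := hcnd z hzsum
  rw [hquad] at h1
  have h2 : 0 ≤ dotProduct z z := by
    simp only [dotProduct]; exact Finset.sum_nonneg fun i _ => mul_self_nonneg _
  have h3 : A p q / 2 - 1 / s ≤ 0 := by nlinarith
  have h4 : 0 < 1 / s := by linarith
  exact one_div_pos.mp h4

/-! ## The variational principle for `E∞ = −A⁻¹ + x xᵀ/s` and the gap of `P∞` from a zero-sum charge map -/

/-- `A · E∞ y = −y + (x·y/s)·1`. [folklore] -/
theorem mulVec_smInvInf (hA : IsUnit A.det) (y : Fin 5 ⊕ Fin 5 → ℝ) :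
    A.mulVec ((smInvInf A).mulVec y)
      = -y + (dotProduct (TwoChannel.xvec2 A) y / TwoChannel.svec2 A) • (fun _ => (1 : ℝ)) := by
  unfold smInvInf
  rw [Matrix.add_mulVec, Matrix.neg_mulVec, Matrix.mulVec_add, Matrix.mulVec_neg, Matrix.mulVec_mulVec,
    Matrix.mul_nonsing_inv _ hA, Matrix.one_mulVec, Matrix.smul_mulVec, Matrix.mulVec_smul]
  congr 1
  have h : (Matrix.vecMulVec (TwoChannel.xvec2 A) (TwoChannel.xvec2 A)).mulVec y
      = dotProduct (TwoChannel.xvec2 A) y • TwoChannel.xvec2 A := by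
    funext i
    simp only [Matrix.mulVec, dotProduct, Matrix.vecMulVec_apply, Pi.smul_apply, smul_eq_mul]
    rw [Finset.sum_mul]
    exact Finset.sum_congr rfl fun j _ => by ring
  rw [h, Matrix.mulVec_smul, mulVec_xvec2 A hA, smul_smul]
  congr 1
  ring

/-- `Σ (E∞ y) = 0` (symmetric `A`). [folklore] -/
theorem sum_smInvInf_mulVec (hsymm : A.IsSymm) (hs : TwoChannel.svec2 A ≠ 0)
    (y : Fin 5 ⊕ Fin 5 → ℝ) : ∑ r, (smInvInf A).mulVec y r = 0 := by
  have h1 : ∑ r, (smInvInf A).mulVec y r = dotProduct (fun _ => (1 : ℝ)) ((smInvInf A).mulVec y) := by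
    simp [dotProduct]
  rw [h1]
  unfold smInvInf
  rw [Matrix.add_mulVec, Matrix.neg_mulVec, dotProduct_add, dotProduct_neg, Matrix.dotProduct_mulVec,
    one_vecMul_inv A hsymm, Matrix.smul_mulVec, dotProduct_smul]
  have h : dotProduct (fun _ => (1 : ℝ)) ((Matrix.vecMulVec (TwoChannel.xvec2 A) (TwoChannel.xvec2 A)).mulVec y)
      = TwoChannel.svec2 A * dotProduct (TwoChannel.xvec2 A) y := by
    simp only [dotProduct, Matrix.mulVec, Matrix.vecMulVec_apply, one_mul, TwoChannel.svec2]
    rw [Finset.sum_mul]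
    refine Finset.sum_congr rfl fun i _ => ?_
    rw [Finset.mul_sum]
    exact Finset.sum_congr rfl fun j _ => by ring
  rw [h, smul_eq_mul]
  field_simp
  ring

/-- ★★ **VARIATIONAL PRINCIPLE:** for symmetric invertible `A`, conditionally negative semidefinite, with `s ≠ 0`: every ZERO-SUM
charge `c` gives a lower bound `2c·y + cᵀAc ≤ yᵀE∞y` (equality at `c = E∞y`). [folklore] -/
theorem quad_smInvInf_ge (hsymm : A.IsSymm) (hA : IsUnit A.det) (hs : TwoChannel.svec2 A ≠ 0)
    (hcnd0 : ∀ c : Fin 5 ⊕ Fin 5 → ℝ, ∑ r, c r = 0 → dotProduct c (A.mulVec c) ≤ 0)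
    (y c : Fin 5 ⊕ Fin 5 → ℝ) (hc : ∑ r, c r = 0) :
    2 * dotProduct c y + dotProduct c (A.mulVec c) ≤ dotProduct y ((smInvInf A).mulVec y) := by
  set cs := (smInvInf A).mulVec y with hcs
  set κ := dotProduct (TwoChannel.xvec2 A) y / TwoChannel.svec2 A with hκ
  have hAcs : A.mulVec cs = -y + κ • (fun _ => (1 : ℝ)) := mulVec_smInvInf A hA y
  have hsum_cs : ∑ r, cs r = 0 := sum_smInvInf_mulVec A hsymm hs y
  have hdiff : ∑ r, (c - cs) r = 0 := by
    simp only [Pi.sub_apply, Finset.sum_sub_distrib, hc, hsum_cs, sub_zero]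
  have key := hcnd0 (c - cs) hdiff
  -- expand `(c − c*)ᵀA(c − c*)`
  have hc1 : dotProduct c (fun _ => (1 : ℝ)) = 0 := by simp [dotProduct, hc]
  have hcs1 : dotProduct cs (fun _ => (1 : ℝ)) = 0 := by simp [dotProduct, hsum_cs]
  have hcAcs : dotProduct c (A.mulVec cs) = -dotProduct c y := by
    rw [hAcs, dotProduct_add, dotProduct_neg, dotProduct_smul, hc1, smul_zero, add_zero]
  have hcsAc : dotProduct cs (A.mulVec c) = -dotProduct c y := by
    rw [Matrix.dotProduct_mulVec, ← Matrix.mulVec_transpose, hsymm.eq, dotProduct_comm, hcAcs]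
  have hcsAcs : dotProduct cs (A.mulVec cs) = -dotProduct cs y := by
    rw [hAcs, dotProduct_add, dotProduct_neg, dotProduct_smul, hcs1, smul_zero, add_zero]
  rw [Matrix.mulVec_sub, sub_dotProduct, dotProduct_sub, dotProduct_sub, hcAcs, hcsAc, hcsAcs] at key
  rw [dotProduct_comm y cs]
  linarith

/-- `P∞ = (E∞)_BB − ½`. [folklore] -/
theorem twoHolePinf_apply_smInvInf (i j : Fin 4 ⊕ Fin 4) :
    twoHolePinf A i j = smInvInf A (TwoChannel.emb i) (TwoChannel.emb j) - (if i = j then (1 : ℝ) / 2 else 0) := by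
  simp only [twoHolePinf, smInvInf, Matrix.of_apply, Matrix.add_apply, Matrix.neg_apply, Matrix.smul_apply,
    Matrix.vecMulVec_apply, smul_eq_mul]
  ring

/-- `wᵀP∞w = ŵᵀE∞ŵ − ½‖w‖²`, `ŵ = pad w`. [folklore] -/
theorem quad_twoHolePinf_eq (w : Fin 4 ⊕ Fin 4 → ℝ) :
    dotProduct w ((twoHolePinf A).mulVec w)
      = dotProduct (pad w) ((smInvInf A).mulVec (pad w)) - (1 / 2) * dotProduct w w := by
  have hE : dotProduct (pad w) ((smInvInf A).mulVec (pad w))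
      = ∑ i : Fin 4 ⊕ Fin 4, ∑ j : Fin 4 ⊕ Fin 4, w i * smInvInf A (TwoChannel.emb i) (TwoChannel.emb j) * w j := by
    simp only [dotProduct, Matrix.mulVec]
    rw [sum_eq_sum_emb_real (F := fun p => pad w p * ∑ q, smInvInf A p q * pad w q) (by simp [(pad_centre w).1])
      (by simp [(pad_centre w).2])]
    refine Finset.sum_congr rfl fun i _ => ?_
    rw [pad_emb, sum_eq_sum_emb_real (F := fun q => smInvInf A (TwoChannel.emb i) q * pad w q)
      (by simp [(pad_centre w).1]) (by simp [(pad_centre w).2]), Finset.mul_sum]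
    refine Finset.sum_congr rfl fun j _ => ?_
    rw [pad_emb]; ring
  rw [hE]
  have h1 : ∀ i, (twoHolePinf A).mulVec w i
      = (∑ j, smInvInf A (TwoChannel.emb i) (TwoChannel.emb j) * w j) - (1 / 2) * w i := by
    intro i
    simp only [Matrix.mulVec, dotProduct, twoHolePinf_apply_smInvInf, sub_mul, Finset.sum_sub_distrib, ite_mul, zero_mul,
      Finset.sum_ite_eq, Finset.mem_univ, if_true]
  have h2 : dotProduct w ((twoHolePinf A).mulVec w)
      = ∑ i, (w i * ∑ j, smInvInf A (TwoChannel.emb i) (TwoChannel.emb j) * w j) - ∑ i, w i * ((1 / 2) * w i) := by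
    simp only [dotProduct, h1, mul_sub, Finset.sum_sub_distrib]
  rw [h2]
  congr 1
  · exact Finset.sum_congr rfl fun i _ => by rw [Finset.mul_sum]; exact Finset.sum_congr rfl fun j _ => by ring
  · simp only [dotProduct, Finset.mul_sum]
    exact Finset.sum_congr rfl fun i _ => by ring

/-- the charge quadratic form: `ŵᵀ(C + Cᵀ + CᵀAC)ŵ = 2(Cŵ)·ŵ + (Cŵ)ᵀA(Cŵ)`. [folklore] -/
theorem quad_chargeForm_eq (C : Matrix (Fin 5 ⊕ Fin 5) (Fin 5 ⊕ Fin 5) ℝ) (u : Fin 5 ⊕ Fin 5 → ℝ) :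
    dotProduct u ((C + C.transpose + C.transpose * A * C).mulVec u)
      = 2 * dotProduct (C.mulVec u) u + dotProduct (C.mulVec u) (A.mulVec (C.mulVec u)) := by
  rw [Matrix.add_mulVec, Matrix.add_mulVec, dotProduct_add, dotProduct_add, ← Matrix.mulVec_mulVec,
    ← Matrix.mulVec_mulVec, Matrix.dotProduct_mulVec u C.transpose, Matrix.vecMul_transpose,
    Matrix.dotProduct_mulVec u C.transpose, Matrix.vecMul_transpose, dotProduct_comm u (C.mulVec u)]
  ring

/-- ★★ **THE GAP FROM A ZERO-SUM CHARGE MAP:** symmetric invertible CND `A` with `s ≠ 0`; a matrix `C` with zero column sums such that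
`ŵᵀ(C + Cᵀ + CᵀAC)ŵ ≥ (g + ½)‖w‖²` for every zero-sum boundary vector `w` (`ŵ = pad w`) ⇒ `wᵀP∞w ≥ g‖w‖²` on zero-sum `w`. [folklore] -/
theorem gap_of_chargeMap (hsymm : A.IsSymm) (hA : IsUnit A.det) (hs : TwoChannel.svec2 A ≠ 0)
    (hcnd0 : ∀ c : Fin 5 ⊕ Fin 5 → ℝ, ∑ r, c r = 0 → dotProduct c (A.mulVec c) ≤ 0)
    (C : Matrix (Fin 5 ⊕ Fin 5) (Fin 5 ⊕ Fin 5) ℝ) (hC : ∀ q, ∑ p, C p q = 0) (g : ℝ)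
    (hM : ∀ w : Fin 4 ⊕ Fin 4 → ℝ, ∑ i, w i = 0 →
      (g + 1 / 2) * dotProduct w w ≤ dotProduct (pad w) ((C + C.transpose + C.transpose * A * C).mulVec (pad w)))
    (w : Fin 4 ⊕ Fin 4 → ℝ) (hw : ∑ i, w i = 0) :
    g * dotProduct w w ≤ dotProduct w ((twoHolePinf A).mulVec w) := by
  set c := C.mulVec (pad w) with hc
  have hcsum : ∑ r, c r = 0 := by
    simp only [hc, Matrix.mulVec, dotProduct]
    rw [Finset.sum_comm]
    refine Finset.sum_eq_zero fun q _ => ?_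
    rw [← Finset.sum_mul, hC q, zero_mul]
  have h1 := hM w hw
  rw [quad_chargeForm_eq] at h1
  have h2 := quad_smInvInf_ge A hsymm hA hs hcnd0 (pad w) c hcsum
  rw [quad_twoHolePinf_eq]
  linarith

end TwoHoleBS

end Summit.HubbardSuperconductivity.HubbardSuperconductivity.Theorems.AnisotropyChord.Transfer.Fibre3

end
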